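import Literature.NumberTheory.GelbartRogawski1991.ThetaDichotomyVocabulary
import Literature.NumberTheory.Automorphic.JacquetModule
import HarnessLib

/-!
# [GelbartRogawski1991 §3.2 (3.2.1)–(3.2.3); Kudla1986 Thm. 2.8; GelbartRogawski1990 §2] THE JACQUET MODULE OF THE LOCAL THETA TYPE
# `X_v(μ, ε, χ_f)` AT A NON-SPLIT PLACE: `r_N(ω³) ≅ ℱ` — it is the `ψθ`-part of the rank-one Weil representation `ω¹(γ_v, ψ_v)`, on which the
# diagonal torus acts by `χθ(d(α, β, ᾱ⁻¹)) = γ_v(α)‖α‖^{1/2} ψθ(β)`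

Topic `NumberTheory/GelbartRogawski1991`; namespace `Literature.NumberTheory.GelbartRogawski1991`.  ONE closed named fact
(`thetaType_nonsplit_jacquetModule : Prop`, a `def`; no `sorry`, no instance, no notation, no theorem); net debt +1 — a PRINTED CITATION.
Cell `hodgecm-mathlib` (D-0151), director g16 topic T7 «GR91 §5 local theta dichotomy for the true packet `{πⁿ(ξ_v), πˢ(ξ_v)}` (D7α local
half, U′-N's sibling)», seat typ-T7a (2026-08-31), node N3 of `F0/P2/T7a-TREE.md` — THE MECHANISM behind both halves of the dichotomy:
with Harish-Chandra's criterion (★-typed `Rogawski1990.u3_isSupercuspidal_iff_jacquet_eq_zero`) it GIVES [GelbartRogawski1990 Prop. 5.2.2]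
(★-typed `GR90Prop522_thetaType_supercuspidal_iff`: `r_N(X_v) = 0 ⟺ ψθ` does not occur `⟺ X_v` supercuspidal `= πˢ(ξ_v)`), and with
Frobenius reciprocity (★ `frobeniusEquiv`, PROVED) it gives the occurring class as a constituent of the principal series `i_G(χθ)` (`= πⁿ(ξ_v)`;
the registered stub K1 `StubThetaInPS` of `Cruxes/H413/Lines/F0_P2GR91NJacquet.lean`, whose `χθ = cmXiTorusChar L v μ_v ψθ⁻¹ ψθ` THIS LETTER
REUSES TOKEN FOR TOKEN).  HONEST LABEL: HC_CM is proved only modulo the printed citations until rung 0 closes; nothing here proves HC_CM.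

THE PRINT.  [GelbartRogawski1991] Invent. Math. 105 (1991), §3.2 «Mixed model», **p. 457** (shelf transcription `GR91-GelbartRogawski1991-Invent105.md`
ADDENDUM, by eye from `img_p457.jpg`): the oscillator representation `ω_ψ^s` of `G = U(3)` realised on `𝒮(E_𝐀, ℱ)`, `ℱ` the space of the `ψ`-representation
`ρ_ψ¹` of the Heisenberg group `N = H(W₂)`; «For `u ∈ U₁(𝐀)`, (3.2.1) `ω_ψ^s(diag(1, u, 1)) Φ(w) = ω_ψ^{s′}(u)(Φ(w))`.  Here `ω_ψ^{s′}` is an oscillator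
representation of `U₁(𝐀)` on `ℱ` …  For `α ∈ E_𝐀*`, (3.2.2) `ω_ψ^s(diag(α, 1, ᾱ⁻¹)) Φ(w) = γ(α) ‖α‖^{1/2} Φ(ᾱw)` where `γ` is a unitary character of
`I_E`.  For `n = [c, t] ∈ N(𝐀)`, (3.2.3) `ω_ψ^s[(c, t)] Φ(w) = ψ(t N_{E/F}(w)) ρ_ψ¹([cw, 0]) Φ(w)`.  These formulas follow from their local counterparts,
discussed in [GR₁, §2].»; §3.2 Remark (1): «The character `γ` appearing above is a Hecke character of `E` whose restriction to `F` is `ω_{E/F}`»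
(= Kudla's splitting character, our `μ`); §5.2 p. 467 L8–11: `ω¹(γ, ψ)`, `ω³(γ, ψ)` «the corresponding oscillator representations» of `U(1)`
and `U(3)`.  CONSEQUENCE (the local computation these formulas encode; [Kudla1986, Thm. 2.8] for the maximal parabolic stabilising an
isotropic line `X` of `V`, with ONE filtration step because the line `W₁` is anisotropic; [MoeglinVignerasWaldspurger1987, Chap. 3 §IV.5]):
the `N`-coinvariants of `ω³_v` are `Φ ↦ Φ(0) ∈ ℱ` (by (3.2.3) the fibres at `w ≠ 0` carry non-trivial characters of the centre `U` of `N` and die;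
at `w = 0`, `N` acts trivially), so `r_N(ω³_v) ≅ ℱ_v = ω¹(γ_v, ψ_v)` with `d(α, β, ᾱ⁻¹) = diag(α, 1, ᾱ⁻¹)·diag(1, β, 1)` acting by
`γ_v(α)‖α‖^{1/2} · ω¹(γ_v, ψ_v)(β)` ((3.2.1)–(3.2.2)); passing to the part where the centre `Z = {d(β, β, β)}` acts by `χ_v` (it acts on `ℱ_v` by
`γ_v(β) ω¹(β)`; `Z ≤ M` and coinvariants commute) leaves the `ψθ = χ_v(γ_v¹)⁻¹`-isotypic part `ℱ_v[ψθ]` of `ω¹(γ_v, ψ_v)` (dimension `≤ 1`,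
★ `finiteDimensional_weightSpace_rankOne`), on which `M` acts by the character `d(α, β, ᾱ⁻¹) ↦ γ_v(α)‖α‖^{1/2} ψθ(β)`.  In the tree's tokens
(★ `cmXiTorusChar L v μslot η₁ η₂ (d(α, β, ᾱ⁻¹)) = η₁(α/ᾱ) μslot(α) ‖α‖^{1/2} η₂(αᾱ⁻¹β)`, ★ `xiTorusChar_apply`, coordinate `i = 0`):
`γ_v(α)‖α‖^{1/2} ψθ(β) = cmXiTorusChar L v μ_v ψθ⁻¹ ψθ (d(α, β, ᾱ⁻¹))` =: `χθ` — EXACTLY the inducing character of K1 `StubThetaInPS` (F0P2-plan (g7)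
design memo §2), so this letter and the registered U′-N pay-down line stand or fall together under one convention audit.

CONVENTIONS (read before paying; the S-SIGN class of slips): (c1) `Representation.jacquetModule` is the UNNORMALISED Jacquet functor
(`N`-coinvariants, `m • [v] = [ρ m v]`, ★ `jacquetModule_mk`); the exponent `‖α‖^{+1/2}` above is print's (3.2.2) as an honest action, no `δ_B^{±1/2}`;
the normalised functor ★ `normalizedJacquet` twists by `δ_B^{-1/2}`, `δ_B^{1/2}(d(α, β, ᾱ⁻¹)) = ‖α‖_E`, so normalised Frobenius lands in
`i_G(μ_v‖·‖^{-1/2} ⊗ ψθ) = i_G(w·χθ)` — same Jordan–Hölder constituents as `i_G(χθ)` [Rogawski1990 §12.1 p. 172] (the consumer's step, not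
asserted here).  (c2) `γ ↔ μ_v := (toHeckeCharacter L μ).semilocalComponent L v` with the SAME orientation as U′-N's `χθ` (if print's `γ` is the
tree's `μ_v⁻¹ = μ_v ∘ c̄`, both letters flip together; `μ_v(ᾱ)⁻¹ = μ_v(α)` for conjugate-symplectic `μ`, so only `μ ↔ μ^c` is at stake).  (c3) the
rank-one representation is read at the Witt kernel line `L₀ = ⟨−d₁d₂d₃⟩` of `V = diag dV` (★ `kernelLineCM`; `V_v ≅ H ⊕ L₀`, `U₁ = U(L₀)`) and
the line `⟨ε⟩` (★ `lineWeilCM`), `ψθ` through ★ `IsThetaCenterChar`.  AUDIT T7-K0 of the sibling letter applies verbatim.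

SCOPE ∕ NOT ASSERTED: non-split `v` only (at split `v` the Jacquet module of the `(GL₁, GL₃)`-type theta lift has TWO exponents); no claim
that the weight space is non-zero (that is the `(U(1), U(1))` dichotomy, ★ `rankOne_theta_dichotomy`) nor which `ε` makes it so; `X_v` is read
on `U(Φ₃)(L⁺_v)` along an ARBITRARY form congruence `(T, a, h)` of `diag dV` (★ `xThetaGqsCM`; torus characters of `B ≤ U(Φ₃)` are insensitive
to the choice up to `B`-conjugacy, which the `∀ (T, a, h)` quantifier makes the letter assert — print fixes one identification `G′_v = G_v`).

* `thetaType_nonsplit_jacquetModule` — the named fact (closed `Prop`): (a) a `ℂ`-linear isomorphism `r_N(X_v) ≃ ℱ_v[ψθ]`; (b) the torus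
  `T = (cmBorelTriple L 3 v).M` acts on `r_N(X_v)` by the scalar `χθ(t)`.

## References
* [GelbartRogawski1991] Invent. Math. 105 (1991): §3.2 (3.2.1)–(3.2.3) + Remarks (1)–(3), pp. 457–458; §5.2 p. 467 L8–11, L25–27.
* [GelbartRogawski1990] Israel Math. Conf. Proc. 2 (1990): §2 (local mixed model), Prop. 5.2.2 — cited through GR91; not held (acq-10743).
* [Kudla1986] S. Kudla, *On the local theta-correspondence*, Invent. Math. 83 (1986) 229–255: Thm. 2.8 (Jacquet modules of the Weil representation).
* [MoeglinVignerasWaldspurger1987] LNM 1291 (1987): Chap. 3 §IV.5 (filtration de Kudla), §IV.4.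
* [Rogawski1990] Ann. of Math. Stud. 123: §1.10 p. 9 (`M`, `N`), §12.1 p. 172, §12.2 (2) p. 174.
* [Liu2021] arXiv:2102.11518: Def. 4.11; App. D §D.1 Steps 1–3.
-/

set_option autoImplicit false

noncomputable section

open NumberField IsDedekindDomain MeasureTheory
open scoped Matrix Kronecker

namespace Literature.NumberTheory.GelbartRogawski1991

open Literature.NumberTheory Literature.NumberTheory.Automorphic Literature.NumberTheory.Automorphic.UnitaryGroup
open Literature.NumberTheory.Automorphic.IdeleClassGroup
open Literature.NumberTheory.Automorphic.Liu2021 Literature.NumberTheory.Automorphic.Liu2021.Def411WeilCarriers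
open Literature.NumberTheory.GaloisRepresentations
open Literature.NumberTheory.Rogawski1990
open Literature.RepresentationTheory

/-! ## §1 The named fact -/

set_option synthInstance.maxHeartbeats 400000 in
set_option maxHeartbeats 8000000 in
/-- **[GelbartRogawski1991 §3.2 (3.2.1)–(3.2.3) p. 457; Kudla1986 Thm. 2.8; GelbartRogawski1990 §2] — THE JACQUET MODULE OF THE LOCAL THETA TYPE AT
A NON-SPLIT PLACE.**  For every CM field `L`, frame data `(e₁, dV)`, reindexing `e₀`, conjugate-symplectic `μ`, continuous unitary `χ_f`, every
place `v` of `L⁺` NOT split in `L`, line class `ε`, character `ψθ` of `E¹_v` with ★ `IsThetaCenterChar L μ χf ε v ψθ` (`ψθ = χ_{f,v}·μ_v⁻¹`), and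
every form congruence `ᵗT̄ · (diag dV)_v · T = a · Φ₃` reading `X_v(μ, ε, χ_f)` on `U(Φ₃)(L⁺_v)` (★ `xThetaGqsCM`):
(a) the Jacquet module `r_N(X_v)` along the Borel `B = TN` of `U(Φ₃)(L⁺_v)` (★ `cmBorelTriple L 3 v`; the `N`-coinvariants, Mathlib
`Representation.Coinvariants` of ★ `ParabolicTriple.restrict`) is `ℂ`-linearly isomorphic to the `ψθ`-weight space `ℱ_v[ψθ]` of GR's rank-one
oscillator representation `ω¹(γ_v, ψ_v)` (★ `lineWeilCM` at the Witt kernel line ★ `kernelLineCM dV` and the line `⟨ε⟩`; ★ `weightSpace`, the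
body of ★ `OccursInLineWeilCM`) — «`r_N(ω³) ≅ ℱ`» cut down to central character `χ_v`; and
(b) the diagonal torus `T = {d(α, β, ᾱ⁻¹)}` acts on `r_N(X_v)` (★ `Representation.jacquetModule`, UNNORMALISED: `t • [x] = [X_v(t) x]`) by the
scalar `χθ(t)`, `χθ := cmXiTorusChar L v μ_v ψθ⁻¹ ψθ`, i.e. `d(α, β, ᾱ⁻¹) ↦ μ_v(α)‖α‖^{1/2} ψθ(β)` — print's (3.2.1)–(3.2.2)
«`ω_ψ^s(diag(α,1,ᾱ⁻¹))Φ(w) = γ(α)‖α‖^{1/2}Φ(ᾱw)`», «`ω_ψ^s(diag(1,u,1))Φ(w) = ω_ψ^{s′}(u)(Φ(w))`» read at `w = 0`; the SAME `χθ` as the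
registered stub K1 `StubThetaInPS` of `Cruxes/H413/Lines/F0_P2GR91NJacquet.lean`.  Hence `dim r_N(X_v) ≤ 1` (★ `finiteDimensional_weightSpace_rankOne`),
`r_N(X_v) ≠ 0 ⟺ ψθ` occurs in `ω¹` (⟹ with ★ Frobenius `X_v ↪ i_G(w·χθ)`: `πⁿ(ξ_v)`), `r_N(X_v) = 0 ⟺ ψθ` does not occur (⟹ with Harish-Chandra's
criterion: supercuspidal, `πˢ(ξ_v)` [GR90 Prop. 5.2.2]).  Conventions (c1)–(c3) of the module docstring; nothing in the tree proves it.
[cite: GelbartRogawski1991, §3.2 (3.2.1)–(3.2.3) p. 457; §3.2 Remark (1) pp. 457–458; §5.2 p. 467 L8–11] [cite: Kudla1986, Thm. 2.8]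
[cite: GelbartRogawski1990, §2; Prop. 5.2.2] [cite: MoeglinVignerasWaldspurger1987, Chap. 3 §IV.5] [cite: Rogawski1990, §1.10 p. 9; §12.1 p. 172] -/
def thetaType_nonsplit_jacquetModule : Prop :=
  ∀ (L : Type) [Field L] [NumberField L] [IsCMField L]
    {n' : ℕ} (e₁ : Fin 3 × Fin 1 ≃ Fin n') (dV : Fin 3 → L) (hdV : ∀ i, IsCMField.complexConj L (dV i) = dV i) (hdV0 : ∀ i, dV i ≠ 0)
    {n₀ : ℕ} (e₀ : Fin 1 × Fin 1 ≃ Fin n₀)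
    (μ : Literature.NumberTheory.Automorphic.IdeleClassGroup L →ₜ* Circle) (hμ : IsConjugateSymplectic L μ)
    (χf : UnitaryGroup.finAdelicOne (↥(maximalRealSubfield L)) L (IsCMField.complexConj L) →* ℂˣ),
    Continuous χf → (∀ z, ‖((χf z : ℂˣ) : ℂ)‖ = 1) →
    ∀ (v : HeightOneSpectrum (𝓞 ↥(maximalRealSubfield L))),
      (∀ w : PlacesOver L v, IsCMField.complexConj L • w.1 = w.1) →
      ∀ (ε : (↥(maximalRealSubfield L))ˣ) (ψθ : ↥(normOneUnits (conjLocal L (IsCMField.complexConj L) v)) →* ℂˣ),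
        IsThetaCenterChar L μ χf ε v ψθ →
        ∀ (T : GL (Fin 3) (UnitaryGroup.LocalRing L v)) (a : UnitaryGroup.LocalRing L v) (ha : IsUnit a)
          (h : formCongr (conjLocal L (IsCMField.complexConj L) v) T ((Matrix.diagonal dV).map (algebraMap L (UnitaryGroup.LocalRing L v))) =
            a • (Matrix.of fun i j : Fin 3 => if i.val + j.val + 1 = 3 then (1 : L) else 0).map (algebraMap L (UnitaryGroup.LocalRing L v))),
          -- (a) `r_N(X_v) ≃ ℱ_v[ψθ]` as `ℂ`-vector spaces
          Nonempty (((cmBorelTriple L 3 v).restrict (xThetaGqsCM L e₁ dV hdV hdV0 μ hμ χf ε v T ha h)).Coinvariants ≃ₗ[ℂ]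
            ↥(weightSpace (lineWeilCM L e₀ (kernelLineCM dV) (complexConj_kernelLineCM dV hdV) (kernelLineCM_ne_zero dV hdV0) μ hμ ε v) id
              (fun u => ((ψθ (localDet (IsCMField.complexConj L) v
                (isUnit_iff_ne_zero.mpr (by rw [Matrix.det_fin_one]; exact JW_apply_ne_zero (↥(maximalRealSubfield L)) L ε))
                (localPiEquiv L (IsCMField.complexConj L) 1 (JW (↥(maximalRealSubfield L)) L ε) v u)) : ℂˣ) : ℂ)))) ∧
          -- (b) the torus acts on `r_N(X_v)` by `χθ = cmXiTorusChar L v μ_v ψθ⁻¹ ψθ`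
          ∀ (t : ↥(cmBorelTriple L 3 v).M) (x : ((cmBorelTriple L 3 v).restrict (xThetaGqsCM L e₁ dV hdV hdV0 μ hμ χf ε v T ha h)).Coinvariants),
            Representation.jacquetModule (xThetaGqsCM L e₁ dV hdV hdV0 μ hμ χf ε v T ha h) (cmBorelTriple L 3 v) t x =
              ((cmXiTorusChar L v ((toHeckeCharacter L μ).semilocalComponent L v) ψθ⁻¹ ψθ t : ℂˣ) : ℂ) • x

end Literature.NumberTheory.GelbartRogawski1991

end
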